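import Summits.ABC.ABC.Theses.DefiniteXi
import Summits.ABC.ABC.Theorems.DefiniteXiFreyModularity
import Summits.ABC.ABC.Theorems.SteinbergCore.Negative.SteinbergCoreDomain
import HarnessLib

/-!
# Crux `SteinbergCore` (stmt-ABC-15024), line `p6_tamagawa_split` — the minimality guard of the
# atom `stub_primeToSixDegreeBound` is LOAD-BEARING

The abc-strength stub of the registered skeleton of stmt-ABC-15024 (child `PrimeToSixDegreeBound` of the
prepared split) reads: for every `ε > 0` there is `C` such that for all coprime `a, b` (`ab(a+b) ≠ 0`),
`N` the conductor of `E_(a,b) = freyCurve a b`, and every datum `D` of `E_(a,b)` at level `N` OF MINIMAL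
DEGREE (`∀ D', D.deg ≤ D'.deg`), `cps (deg D) ≤ C N^(2+ε)` (`cps n = n / (2^{v₂ n} 3^{v₃ n})`).

This file records, in the kernel, the strategist's remark S8 (STRATEGY-CENSUS v3 §Strengthen): **the guard
"of minimal degree" cannot be dropped** — without it the statement is FALSE at every single Frey curve that
carries one datum, because composing a parametrisation `φ` with multiplication by `5^k` on the curve is
again a parametrisation datum, of degree `25^k · deg φ`, and `cps (25^k d) = 25^k cps d`.

* `exists_datum_deg_eq_sq_mul` — for every datum `D` of any `W` at level `N` and every integer `m ≠ 0`
  there is a datum with the same newform and degree `m² · deg D` (the datum `[m] ∘ φ`: same lattice and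
  uniformisation, Manin constant `m c`; the fibre count is the tree's
  `finite_setOf_natCard_fibre_zsmul_ne`, p-landed with `FreyModularity`'s transport file).
* `primeToSix_pow_twentyfive_mul` — `cps (25^k n) = 25^k cps n`.
* `primeToSixDegreeBound_false_without_minimality` — `FreyModularity → ¬ (the stub with the minimality
  guard dropped)`; the only use of `FreyModularity` (stmt-ABC-11340, true in print: Wiles/BCDT) is ONE datum
  on the curve `E_(1,1) : y² = x(x−1)(x+1)`.

So any proof of the atom must USE minimality (equivalently: must bound the degree of the OPTIMAL quotient /
the `X₀(N)`-optimal curve, not of an arbitrary parametrisation), exactly as the crux `B` itself carries no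
datum and is immune (Disproof.lean §B).  Test for whoever files child 2 of the split: keep the guard
verbatim (children.json does).  Nothing here bears on the truth of the guarded atom (abc-strength, p160000).
-/

-- `Summit.<Summit>.<Problem>` is the mandated summit-side namespace (CONVENTIONS §2); for the single-conjunct
-- summit `ABC` the two coincide, so the duplicate `ABC.ABC` is deliberate.
set_option linter.dupNamespace false

noncomputable section

open scoped MatrixGroups ModularForm

namespace Summit.ABC.ABC.Theorems.SteinbergCorePrimeToSixMinimality

open CongruenceSubgroup UpperHalfPlane
open Literature.NumberTheory.EllipticCurves Literature.NumberTheory.EllipticCurves.ModularForms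
open Summit.ABC.ABC.Theses.DefiniteXi
open Summit.ABC.ABC.Theorems.SteinbergCore.Negative (primeToSix_mul one_le_primeToSix_iff)

/-! ## (1) The datum `[m] ∘ φ` -/

/-- **Composing a modular parametrisation with `[m]`.**  If `D` is a modular parametrisation datum of `W`
at level `N` and `m ≠ 0` is an integer, then `W` carries a datum at level `N` with the same newform and
degree `m² · deg D`: keep the newform, the Néron lattice and the uniformisation, replace the Manin constant
`c` by `m c` (`m c Λ_f ⊆ m Λ_E ⊆ Λ_E`); the parametrisation becomes `τ ↦ m • φ(τ)`, whose fibres on `Y₀(N)`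
have exactly `m² · deg` orbits off a finite set (`finite_setOf_natCard_fibre_zsmul_ne`: every fibre of `[m]`
on `W(ℂ) ≅ ℂ/Λ_E` has `m²` points, Silverman AEC III.6.4(b)). [cite: SilvermanAEC2009, Cor. III.6.4(b)] -/
theorem exists_datum_deg_eq_sq_mul {W : WeierstrassCurve ℚ} [W.IsElliptic] {N : ℕ} [NeZero N]
    (D : ModularParametrizationData W N) (m : ℤ) (hm : m ≠ 0) :
    ∃ D' : ModularParametrizationData W N, D'.f = D.f ∧ D'.deg = m.natAbs ^ 2 * D.deg := by
  refine ⟨{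
    f := D.f
    isNewformOf := D.isNewformOf
    L := D.L
    isNeronLattice := D.isNeronLattice
    uniformize := D.uniformize
    ker_uniformize := D.ker_uniformize
    uniformize_surjective := D.uniformize_surjective
    uniformize_spec := D.uniformize_spec
    c := m * D.c
    smul_periodLattice_le := ?_
    deg := m.natAbs ^ 2 * D.deg
    deg_pos := Nat.mul_pos (pow_pos (Int.natAbs_pos.mpr hm) 2) D.deg_pos
    deg_spec := ?_ }, rfl, rfl⟩
  · -- `m c Λ_f ⊆ Λ_E`
    intro z hz
    rw [Int.cast_mul, mul_assoc, ← zsmul_eq_mul]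
    exact D.L.lattice.smul_mem m (D.smul_periodLattice_le z hz)
  · -- the fibre count of `τ ↦ m • φ(τ)`
    have hφ : ∀ τ : ℍ, D.uniformize (((m * D.c : ℤ) : ℂ) * eichlerIntegral D.f τ) = m • D.φ τ := by
      intro τ
      rw [Int.cast_mul, mul_assoc, ← zsmul_eq_mul, map_zsmul]
      rfl
    refine (finite_setOf_natCard_fibre_zsmul_ne D m hm).subset fun P hP ↦ ?_
    simp only [Set.mem_setOf_eq, hφ] at hP
    exact hP

/-! ## (2) `cps` of a multiple by a power of `25` -/

/-- `cps n = n` for `n` coprime to `6` (no factor `2`, no factor `3`). [folklore] -/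
theorem primeToSix_eq_self_of_not_dvd {n : ℕ} (h2 : ¬ 2 ∣ n) (h3 : ¬ 3 ∣ n) :
    n / (ordProj[2] n * ordProj[3] n) = n := by
  rw [Nat.factorization_eq_zero_of_not_dvd h2, Nat.factorization_eq_zero_of_not_dvd h3]
  simp

/-- `cps (25^k) = 25^k`. [folklore] -/
theorem primeToSix_pow_twentyfive (k : ℕ) :
    25 ^ k / (ordProj[2] (25 ^ k) * ordProj[3] (25 ^ k)) = 25 ^ k := by
  refine primeToSix_eq_self_of_not_dvd (fun h => ?_) (fun h => ?_)
  · have := Nat.Prime.dvd_of_dvd_pow Nat.prime_two h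
    omega
  · have := Nat.Prime.dvd_of_dvd_pow Nat.prime_three h
    omega

/-- **`cps (25^k · n) = 25^k · cps n`** (`cps` is multiplicative, `primeToSix_mul`). [folklore] -/
theorem primeToSix_pow_twentyfive_mul (k n : ℕ) :
    25 ^ k * n / (ordProj[2] (25 ^ k * n) * ordProj[3] (25 ^ k * n)) =
      25 ^ k * (n / (ordProj[2] n * ordProj[3] n)) := by
  rw [primeToSix_mul, primeToSix_pow_twentyfive]

/-! ## (3) The guard is load-bearing -/

/-- **The minimality guard of `stub_primeToSixDegreeBound` is load-bearing.**  Granting `FreyModularity`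
(stmt-ABC-11340: every Frey curve carries a parametrisation datum at its conductor level — Wiles/BCDT, true
in print), the stub WITH THE GUARD `(∀ D', D.deg ≤ D'.deg)` DROPPED is false: at the single curve
`E_(1,1) : y² = x(x−1)(x+1)` (coprime pair `(1,1)`, `1·1·2 ≠ 0`, conductor `N ≥ 1`) a datum `D₀` exists, and
for every `k` the datum `[5^k] ∘ φ₀` (`exists_datum_deg_eq_sq_mul`) has `cps (deg) = 25^k · cps (deg D₀) ≥ 25^k`
(`primeToSix_pow_twentyfive_mul`, `1 ≤ cps n ↔ n ≠ 0`), which exceeds `C · N^(2+ε)` at `ε = 1` for `k`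
large — whatever `C` is.  (Kernel form of remark S8 of `Cruxes/SteinbergCore/STRATEGY-CENSUS.md`.) [folklore] -/
theorem primeToSixDegreeBound_false_without_minimality : Summit.ABC.ABC.Theses.DefiniteXi.FreyModularity → ¬ (∀ ε : ℝ, 0 < ε → ∃ C : ℝ, ∀ a b : ℤ, IsCoprime a b → a * b * (a + b) ≠ 0 → ∀ (N : ℕ) [NeZero N], (Literature.NumberTheory.EllipticCurves.freyCurve a b).conductorNorm ℤ = N → ∀ D : Literature.NumberTheory.EllipticCurves.ModularForms.ModularParametrizationData (Literature.NumberTheory.EllipticCurves.freyCurve a b) N, ((D.deg / (ordProj[2] D.deg * ordProj[3] D.deg) : ℕ) : ℝ) ≤ C * (N : ℝ) ^ (2 + ε)) := by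
  intro hMod h
  obtain ⟨C, hC⟩ := h 1 one_pos
  -- the curve `E_(1,1)`
  have hab : IsCoprime (1 : ℤ) 1 := isCoprime_one_left
  have h0 : (1 : ℤ) * 1 * (1 + 1) ≠ 0 := by norm_num
  haveI := isElliptic_freyCurve h0
  set N : ℕ := (freyCurve 1 1).conductorNorm ℤ with hN
  haveI : NeZero N := ⟨((freyCurve (1 : ℤ) 1).conductorNorm_pos_holds).ne'⟩
  obtain ⟨D₀⟩ := hMod 1 1 hab h0 N rfl
  -- `k` with `C · N³ < 25^k`
  obtain ⟨k, hk⟩ : ∃ k : ℕ, C * (N : ℝ) ^ ((2 : ℝ) + 1) < (25 : ℝ) ^ k :=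
    pow_unbounded_of_one_lt _ (by norm_num)
  -- the datum `[5^k] ∘ φ₀`, of degree `25^k · deg D₀`
  have h5 : ((5 : ℤ) ^ k) ≠ 0 := pow_ne_zero _ (by norm_num)
  obtain ⟨D, -, hdeg⟩ := exists_datum_deg_eq_sq_mul D₀ ((5 : ℤ) ^ k) h5
  have habs : ((5 : ℤ) ^ k).natAbs ^ 2 = 25 ^ k := by
    rw [Int.natAbs_pow, show ((5 : ℤ).natAbs) = 5 from rfl, ← pow_mul, mul_comm, pow_mul]
    norm_num
  rw [habs] at hdeg
  -- `cps (deg D) = 25^k · cps (deg D₀) ≥ 25^k`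
  have hcps : D.deg / (ordProj[2] D.deg * ordProj[3] D.deg) =
      25 ^ k * (D₀.deg / (ordProj[2] D₀.deg * ordProj[3] D₀.deg)) := by
    rw [hdeg, primeToSix_pow_twentyfive_mul]
  have h1 : 1 ≤ D₀.deg / (ordProj[2] D₀.deg * ordProj[3] D₀.deg) :=
    (one_le_primeToSix_iff _).mpr D₀.deg_pos.ne'
  have hge : 25 ^ k ≤ D.deg / (ordProj[2] D.deg * ordProj[3] D.deg) := by
    rw [hcps]
    exact Nat.le_mul_of_pos_right _ h1
  have hgeR : (25 : ℝ) ^ k ≤ ((D.deg / (ordProj[2] D.deg * ordProj[3] D.deg) : ℕ) : ℝ) := by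
    exact_mod_cast hge
  -- the bound at `(1, 1, N, D)`
  have hle := hC 1 1 hab h0 N rfl D
  exact (not_le.mpr hk) (hgeR.trans hle)

end Summit.ABC.ABC.Theorems.SteinbergCorePrimeToSixMinimality

end
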